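import Summits.QuantumFields.BalabanUV.T4Continuum.Support.NE7EnergyGradRateWLogGeneric
import Summits.QuantumFields.BalabanUV.T4Continuum.Support.NE7EnergyClassPoincareGeneric
import Summits.QuantumFields.BalabanUV.T4Continuum.Support.NE7AllMinimisersSmallGeneric
import Summits.QuantumFields.BalabanUV.T4Continuum.Support.NE7EnergyRateWSU2End
import HarnessLib

/-!
# NE7EnergyGradRateWLogGenericEnd — PORT MAP P3.6e: gen 108's `NE7EnergyGradRateWSU2LogEnd` AT `d = 4`, ANY BLOCK SIZE `L ≥ 2`, ANY `U(n)` — (i) the displays of P3.6d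
# `ne3EnergyGradRateWSup_log_L` discharged by ✓ p807957 `classPackage` (**`ne3EnergyGradRateWSup_log_anyGroup_L`**, no displayed class hypothesis); (ii) the END's currency
# over the small data (**`ne3EnergyGradRateWSup_smallData_log_L`**): `b = ε∕4` via the road's ✓ p810303 `all_minimisers_small_generic`, `residualScale_mono_b`, the competitor line
# `ε∕4 + 226·320²·L²·(ε∕4)² ≤ ε` folded into `ε₀` (`ε ≤ 12∕(226·320²·L²)`)

Cell `pub-balaban`, rung (B)+1 sub-cell t4, lineage `b2b-balaban-t4-ne7b-p1` (row NE7b OWNER + CRUX PROVER), generation 156 — PORT MAP item P3.6e of the road t4-ne7-p1 g109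
([NE7P1-G109-INBOX-3]; memo `t4/b2b-balaban-t4-ne7-p1-g109/ROAD-G109.md` §3, recipe `2 ↦ L`), claimed [NE7bP1-G156-INBOX-6].  Proof = gen 108's verbatim under the recipe.
WHAT ([folklore]; 0 def, 0 sorry).  `ne3EnergyGradRateWSup_log_anyGroup_L`, **`ne3EnergyGradRateWSup_smallData_log_L`** (the T-E_w♯ + (Gᶜ_w) input of the docked END at block size
`L`, modulo the log-tolerant (10)-type letters — theorems for every minimiser over the small data by ✓ p811267 `all_minimisers_fluxGrad_generic`).
HONEST FRAMING (page 1): composition; the log-tolerant flux-gradient letters are HYPOTHESES here; nothing of Bałaban's asserted as an axiom; constants existential; NOT NE3∕NE7 as spine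
nodes; row NE7b (`T4WeightBudget.RelWeightBound`) NOT PRINTED ∕ NOT PROVED; spine count = dagwriter∕referees' call; finite 4-torus — NOT infinite volume, NOT mass gap, NOT
BetaPertH, NOT Clay (continuum YM on T⁴ ⇐ BetaPertH ∧ nine spine estimates).
-/

set_option autoImplicit false

open scoped BigOperators Matrix Matrix.Norms.L2Operator
open NormedSpace Finset Set

namespace Summit.QuantumFields.BalabanUV.T4Continuum.NE7EnergyGradRateWLogGenericEnd

open Literature.MathematicalPhysics.QuantumFieldTheory.Balaban1983to89
open B7Prop1Explicit B7Prop2Explicit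
open T4AveragingDeficitWall (IsUnitaryCfg IsSkewDir SmallField vary Ad covGrad flux)
open T4AveragingDeficitWallBoundary (IsPeriodicCfg periodBox)
open AveragingDeficitPeriodicCounting (IsPeriodicDir)
open MinimalActionSandwich (IsMinimiser)
open MinimalActionRate (sfClass Regular)
open NE3EnergyShapes (IsUnitarySite IsPeriodicSite residualScale residualScale_nonneg)
open NE3EnergyWeightedShapes (energyNormW energyNormW_nonneg)
open NE7EnergyGradRateWLogGeneric (ne3EnergyGradRateWSup_log_L)
open NE7EnergyClassPoincareGeneric (classPackage)
open NE7EnergyRateWSU2End (residualScale_mono_b)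
open NE7AllMinimisersSmallGeneric (all_minimisers_small_generic)

noncomputable section

variable {n : Type} [Fintype n] [DecidableEq n]

/-- **T-E_w♯ + (Gᶜ_w) AT BLOCK SIZE `L ≥ 2`, ANY `U(n)`, NO DISPLAYED CLASS HYPOTHESIS, MODULO THE LOG-TOLERANT (10)-TYPE LETTERS** (P3.6d with its three displays discharged by
`classPackage` at `d = 4`). [folklore] -/
theorem ne3EnergyGradRateWSup_log_anyGroup_L [Nonempty n] {L : ℕ} (hL : 2 ≤ L) :
    ∃ ε₀ : ℝ, 0 < ε₀ ∧ ∀ ε : ℝ, 0 < ε → ε ≤ ε₀ → ∀ b g c : ℝ, 0 ≤ b → b + 226 * 320 ^ 2 * (L : ℝ) ^ 2 * b ^ 2 ≤ ε → 0 < g → 0 ≤ c →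
      ∀ θ : ℝ, 0 < θ → θ ^ 18 = ((L : ℝ))⁻¹ →
      ∃ C s : ℝ, 0 ≤ C ∧ 0 ≤ s ∧ ∀ (N : ℕ) [NeZero N], ∃ ΛG : ℝ, 0 ≤ ΛG ∧ ∀ (dom : Set (Site 4 → Fin 4 → (Matrix n n ℂ)ˣ)),
        ∀ k : ℕ, 1 ≤ k → ∀ V ∈ dom, ∀ UA UB : Site 4 → Fin 4 → (Matrix n n ℂ)ˣ,
          IsMinimiser 4 (sfClass 4 L N ε) L N k V UA → IsMinimiser 4 (sfClass 4 L N ε) L N (k + 1) V UB → Regular 4 L N b g (k + 1) UB →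
          (∀ (x : Site 4) (κ : Fin 4) (π : T4AveragingDeficitWall.Plane 4), ‖covGrad UA (flux UA) x κ π‖ ≤ c * (1 + (k : ℝ)) / ((L : ℝ) ^ k) ^ 3) →
          (∀ (x : Site 4) (κ : Fin 4) (π : T4AveragingDeficitWall.Plane 4), ‖covGrad UB (flux UB) x κ π‖ ≤ c * (1 + ((k + 1 : ℕ) : ℝ)) / ((L : ℝ) ^ (k + 1)) ^ 3) →
          ∃ (u : Site 4 → (Matrix n n ℂ)ˣ) (Z : Site 4 → Fin 4 → Matrix n n ℂ),
            IsUnitarySite u ∧ IsPeriodicSite u ((N * L ^ k : ℕ) : ℤ) ∧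
            IsSkewDir Z ∧ IsPeriodicDir Z ((N * L ^ k : ℕ) : ℤ) ∧
            gaugeAct u UA = vary (rescale L (bavg L UB)) Z 1 ∧
            energyNormW L k (rescale L (bavg L UB)) Z (periodBox (N * L ^ k)) ≤ C * residualScale 4 L N b g k ∧
            (∀ (x : Site 4) (κ : Fin 4), ‖Z x κ‖ ≤ s * (((L : ℝ))⁻¹) ^ k) ∧
            (∀ (κ : Fin 4) (x : Site 4) (μ : Fin 4),
              ‖Ad (rescale L (bavg L UB) (x + e κ) μ) (Z (x + e μ) κ) - Z x κ‖ ≤ ΛG * θ ^ (38 * k)) := by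
  obtain ⟨θ₀, CF, CE, hθ₀, -, -, hCE, -, hcap, hls, -, hPE⟩ := classPackage (n := n) (d := 4) (by norm_num) hL
  have hcap' : 512 * (((4 : ℕ) : ℝ) + 1) * (((4 : ℕ) : ℝ) + 4) * (L : ℝ) ^ 2 * θ₀ ≤ 1 := by
    push_cast at hcap ⊢
    nlinarith [hθ₀, sq_nonneg (L : ℝ)]
  exact ne3EnergyGradRateWSup_log_L (n := n) hL hCE hθ₀ hcap' (fun hε hεθ k => hls hε hεθ k)
    (fun N _ hN ε hε hεθ j W hW => hPE hN hε hεθ j W hW)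

/-- **T-E_w♯ + (Gᶜ_w) IN THE END's CURRENCY OVER THE SMALL DATA, AT BLOCK SIZE `L ≥ 2`, ANY `U(n)`, MODULO THE LOG-TOLERANT (10)-TYPE LETTERS** (gen 108's
`ne3EnergyGradRateWSup_SU2_smallData_log` under the recipe; `b = ε∕4`). [folklore] -/
theorem ne3EnergyGradRateWSup_smallData_log_L [Nonempty n] {L : ℕ} (hL : 2 ≤ L) :
    ∃ ε₀ : ℝ, 0 < ε₀ ∧ ∀ ε : ℝ, 0 < ε → ε ≤ ε₀ → ∀ (N : ℕ) [NeZero N], 1 ≤ N → ∃ δV : ℝ, 0 < δV ∧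
      ∀ g c : ℝ, 0 < g → 0 ≤ c → ∀ θ : ℝ, 0 < θ → θ ^ 18 = ((L : ℝ))⁻¹ →
      ∃ C ΛG : ℝ, 0 ≤ C ∧ 0 ≤ ΛG ∧
        ∀ dom : Set (Site 4 → Fin 4 → (Matrix n n ℂ)ˣ),
          dom ⊆ {V : Site 4 → Fin 4 → (Matrix n n ℂ)ˣ | IsUnitaryCfg V ∧ IsPeriodicCfg V (N : ℤ) ∧ SmallField V δV} →
          ∀ k : ℕ, 1 ≤ k → ∀ V ∈ dom, ∀ UA UB : Site 4 → Fin 4 → (Matrix n n ℂ)ˣ,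
            IsMinimiser 4 (sfClass 4 L N ε) L N k V UA → IsMinimiser 4 (sfClass 4 L N ε) L N (k + 1) V UB → Regular 4 L N ε g (k + 1) UB →
            (∀ (x : Site 4) (κ : Fin 4) (π : T4AveragingDeficitWall.Plane 4), ‖covGrad UA (flux UA) x κ π‖ ≤ c * (1 + (k : ℝ)) / ((L : ℝ) ^ k) ^ 3) →
            (∀ (x : Site 4) (κ : Fin 4) (π : T4AveragingDeficitWall.Plane 4), ‖covGrad UB (flux UB) x κ π‖ ≤ c * (1 + ((k + 1 : ℕ) : ℝ)) / ((L : ℝ) ^ (k + 1)) ^ 3) →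
            ∃ (u : Site 4 → (Matrix n n ℂ)ˣ) (Z : Site 4 → Fin 4 → Matrix n n ℂ),
              IsUnitarySite u ∧ IsPeriodicSite u ((N * L ^ k : ℕ) : ℤ) ∧
              IsSkewDir Z ∧ IsPeriodicDir Z ((N * L ^ k : ℕ) : ℤ) ∧
              gaugeAct u UA = vary (rescale L (bavg L UB)) Z 1 ∧
              energyNormW L k (rescale L (bavg L UB)) Z (periodBox (N * L ^ k)) ≤ C * residualScale 4 L N ε g k ∧
              (∀ (κ : Fin 4) (x : Site 4) (μ : Fin 4),
                ‖Ad (rescale L (bavg L UB) (x + e κ) μ) (Z (x + e μ) κ) - Z x κ‖ ≤ ΛG * θ ^ (38 * k)) := by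
  obtain ⟨ε₁, hε₁, H1⟩ := ne3EnergyGradRateWSup_log_anyGroup_L (n := n) hL
  obtain ⟨ε₂, hε₂, H2⟩ := all_minimisers_small_generic (n := n) hL
  have hcL : (0 : ℝ) < 12 / (226 * 320 ^ 2 * (L : ℝ) ^ 2) := by
    have : (0 : ℝ) < (L : ℝ) := by exact_mod_cast (show 0 < L by omega)
    positivity
  refine ⟨min ε₁ (min ε₂ (12 / (226 * 320 ^ 2 * (L : ℝ) ^ 2))), lt_min hε₁ (lt_min hε₂ hcL), ?_⟩
  intro ε hε hεle N _ hN
  have hεε₁ : ε ≤ ε₁ := hεle.trans (min_le_left _ _)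
  have hεε₂ : ε ≤ ε₂ := hεle.trans ((min_le_right _ _).trans (min_le_left _ _))
  have hε12 : ε ≤ 12 / (226 * 320 ^ 2 * (L : ℝ) ^ 2) := hεle.trans ((min_le_right _ _).trans (min_le_right _ _))
  obtain ⟨δV, hδV, Hsmall⟩ := H2 ε hε hεε₂ N hN
  refine ⟨δV, hδV, ?_⟩
  intro g c hg hc θ hθ hθ18
  -- the theorem at `b = ε/4`: the line `ε/4 + c(L)·(ε/4)² ≤ ε` from `c(L)·ε ≤ 12`
  have hb : (0 : ℝ) ≤ ε / 4 := by positivity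
  have hL2 : (0 : ℝ) < 226 * 320 ^ 2 * (L : ℝ) ^ 2 := by
    have : (0 : ℝ) < (L : ℝ) := by exact_mod_cast (show 0 < L by omega)
    positivity
  have hcε : 226 * 320 ^ 2 * (L : ℝ) ^ 2 * ε ≤ 12 := by
    rw [le_div_iff₀ hL2] at hε12; linarith
  have hbq : ε / 4 + 226 * 320 ^ 2 * (L : ℝ) ^ 2 * (ε / 4) ^ 2 ≤ ε := by
    have e : 226 * 320 ^ 2 * (L : ℝ) ^ 2 * (ε / 4) ^ 2 = (226 * 320 ^ 2 * (L : ℝ) ^ 2 * ε) * ε / 16 := by ring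
    rw [e]
    nlinarith
  obtain ⟨C, s, hC, -, HC⟩ := H1 ε hε hεε₁ (ε / 4) g c hb hbq hg hc θ hθ hθ18
  obtain ⟨ΛG, hΛG, HN⟩ := HC N
  refine ⟨C, ΛG, hC, hΛG, fun dom hdom => ?_⟩
  intro k hk V hV UA UB hA hB hreg hgA hgB
  -- every minimiser of the `ε`-class is `SmallField ((ε/4)/M²)`: `U_B` is `Regular (ε/4) g`
  have hsmallB := Hsmall V (hdom hV) (k + 1) UB hB
  have hreg' : Regular 4 L N (ε / 4) g (k + 1) UB := ⟨hreg.unitary, hreg.periodic, hsmallB, hreg.grad⟩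
  obtain ⟨u, Z, hu, huP, hZs, hZP, hgauge, hE, -, hG⟩ := HN dom k hk V hV UA UB hA hB hreg' hgA hgB
  refine ⟨u, Z, hu, huP, hZs, hZP, hgauge, hE.trans (mul_le_mul_of_nonneg_left ?_ hC), hG⟩
  exact residualScale_mono_b 4 L N k hb (by linarith)

end

end Summit.QuantumFields.BalabanUV.T4Continuum.NE7EnergyGradRateWLogGenericEnd
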